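import Literature.AlgebraicGeometry.Frobenioids.ArchimedeanPullbacks
import Literature.AlgebraicGeometry.Frobenioids.ArchimedeanCircleGeometry
import Literature.AlgebraicGeometry.Frobenioids.CircleOpensProofs2
import Literature.AlgebraicGeometry.Frobenioids.ArchimedeanSlitMorphisms
import HarnessLib

/-!
# Frobenioids II, Proposition 3.4 (viii) at the level of `F₀`: FSM-morphisms between complex objects
# have DENSE angular image; the case `F₀ = N₀` of the FSMI-factorisation
# (abc-iut cell, layer L1, node `FrdII:Prop3.4(viii)/P34-L12`, chain LC-L1-2)

Mochizuki, *The geometry of Frobenioids II: poly-Frobenioids*, Kyushu J. Math. **62** (2008)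
401–460, §3, Proposition 3.4 (viii), proof, journal p. 427 ll. 6–46 (= kurims p. 32)
[cite: MochizukiFrdII2008, Prop 3.4 (viii) p.32]:

> "I claim that `F₀` is of FSMFF-type. Indeed, let `φ : A → B` be an FSM-morphism of `F₀` …
> Now suppose that `A`, `B` are complex. Then observe that if the isometric base-isomorphism `φ` is
> linear, then it is an isometric pre-step, hence (cf. the fiberwise-surjectivity of `φ`,
> Lemma 3.2 (ix) and Example 3.3 (v)) either an isomorphism or a slit morphism. … Thus, we conclude
> that `φ` factors as a composite of finitely many FSMI-morphisms."

PROOF-ONLY file (nothing defined), sub-DAG row `P34-L12` (`F0FSMFactorsFSMI`): condition (a) of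
"FSMFF-type" ([FrdI] §0, `IsOfFSMFFType.factors`) for `F₀` between COMPLEX objects. Real objects are
deliberately excluded: the typed item (viii) is refuted at `π = 𝟭 D₀` through a complex→real
FSM-arrow (`ArchimedeanFSMFFCounterexample.lean`, abc-iut-L1-d3), and the repaired reading is the
complex regime (`ArchimedeanFSMRegime.lean`, L1-lead RULING R37).

* §1 `NormOne.eq_univ_of_forall_inter_nonempty`: Lemma 3.2 (ix) (`CircleOpens.ItemIX_holds`, on
  Mathlib's `Circle`) transported to `O_ℂ^× = normOneSubgroup ℂ`.
* §2 the `C₀`-level core, for an arrow `f = (b, d, c) : X → Y` of `C₀` into a COMPLEX object with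
  angular image `B_f := (c/|c|) · B_X^d` read in the base-changed region `A_Y|_b`:
  `C0.smul_dir_pow_inter_nonempty_of_fill` — if every inclusion of a sub-region `W ↪ Y` fits into
  a square `δ_X ≫ f = δ_W ≫ (W ↪ Y)` (what fiberwise surjectivity in `A₀`/`N₀`/`R₀` supplies), then
  `B_f` is DENSE in the angular part of `A_Y|_b`; `C0.smul_dir_pow_eq_or_slit_of_fill` — hence
  either `B_f` fills it, or `Y` is naively isotropic and `B_f = S¹ ∖ {z₀}`.
* §3 `F₀ = N₀`: `N0.isFSMI_of_isFSM_of_not_isIso` — an FSM-morphism of `N₀` between complex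
  objects that is not an isomorphism is an FSMI-morphism (a slit morphism; irreducibility because an
  intermediate angular part containing `S¹ ∖ {pt}` is `S¹` or `S¹ ∖ {pt}`, and region-filling linear
  isometries are invertible, `C0.isIso_of_isometry_of_dir`); `N0.exists_isFSMIChain_of_isFSM` —
  the printed conclusion "factors as a composite of finitely many FSMI-morphisms" (one term).
The cases `F₀ = R₀`, `F₀ = A₀` (prime factorisation of `deg_Fr` followed by at most one slit
morphism) are filed separately over §2. No side is taken on [IUTchIII] Cor. 3.12.
-/

namespace Literature.AlgebraicGeometry.Frobenioids

open CategoryTheory Set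
open scoped Pointwise

noncomputable section

namespace ArchFrd

/-! ### Lemma 3.2 (ix) on `O_ℂ^×` -/

/-- **Lemma 3.2 (ix) on `O_ℂ^× = S¹`**: if `S ⊊ B` are [nonempty] connected open subsets of `O_ℂ^×`
and `S` meets every [nonempty] connected open subset of `B`, then `B = O_ℂ^×` and `B ∖ S` has at most
one point (transport of `CircleOpens.ItemIX_holds` along `O_ℂ^× ≅ S¹`).
[cite: MochizukiFrdII2008, Lem 3.2 (ix) p.26] -/
theorem NormOne.eq_univ_of_forall_inter_nonempty {S B : Set ↥(normOneSubgroup ℂ)}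
    (hS : IsConnected S) (hSo : IsOpen S) (hB : IsConnected B) (hBo : IsOpen B) (hSB : S ⊆ B)
    (hne : S ≠ B)
    (h : ∀ D : Set ↥(normOneSubgroup ℂ), IsConnected D → IsOpen D → D ⊆ B → (S ∩ D).Nonempty) :
    B = univ ∧ (B \ S).Subsingleton := by
  obtain ⟨-, e, -, -⟩ := exists_unitCircleEquiv
  have himS : e.symm '' S = e ⁻¹' S := congrFun e.image_symm S
  have himB : e.symm '' B = e ⁻¹' B := congrFun e.image_symm B
  have hS' : IsConnected (e ⁻¹' S) := by
    rw [← himS]; exact hS.image _ e.symm.continuous.continuousOn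
  have hB' : IsConnected (e ⁻¹' B) := by
    rw [← himB]; exact hB.image _ e.symm.continuous.continuousOn
  have hset : CircleOpens.Setting (e ⁻¹' S) (e ⁻¹' B) :=
    ⟨hS', e.isOpen_preimage.mpr hSo, hB', e.isOpen_preimage.mpr hBo, preimage_mono hSB⟩
  have hne' : e ⁻¹' S ≠ e ⁻¹' B := fun heq => hne (by
    have := congrArg (fun T => e '' T) heq
    simpa only [image_preimage_eq _ e.surjective] using this)
  have hnoD : ¬ ∃ D : Set Circle, IsConnected D ∧ IsOpen D ∧ D ⊆ e ⁻¹' B ∧ e ⁻¹' S ∩ D = ∅ := by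
    rintro ⟨D, hDc, hDo, hDB, hDS⟩
    have hD1 : IsConnected (e '' D) := hDc.image _ e.continuous.continuousOn
    have hD2 : IsOpen (e '' D) := e.isOpenMap D hDo
    have hD3 : e '' D ⊆ B := by
      rintro _ ⟨x, hx, rfl⟩; exact hDB hx
    obtain ⟨z, hzS, ⟨x, hxD, rfl⟩⟩ := h _ hD1 hD2 hD3
    have : x ∈ e ⁻¹' S ∩ D := ⟨hzS, hxD⟩
    rw [hDS] at this
    exact this
  obtain ⟨hBu, hsub⟩ := CircleOpens.ItemIX_holds _ _ hset hne' hnoD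
  refine ⟨?_, ?_⟩
  · apply eq_univ_of_forall
    intro z
    have : e.symm z ∈ e ⁻¹' B := by rw [hBu]; trivial
    simpa using this
  · intro z hz w hw
    have hz' : e.symm z ∈ e ⁻¹' B \ e ⁻¹' S := by simpa using hz
    have hw' : e.symm w ∈ e ⁻¹' B \ e ⁻¹' S := by simpa using hw
    exact e.symm.injective (hsub hz' hw')

/-- A subset of `O_ℂ^×` containing the complement of a point is that complement or everything.
[cite: MochizukiFrdII2008, Lem 3.2 (iii) p.25] -/
theorem NormOne.eq_univ_or_eq_compl_of_compl_subset {T : Set ↥(normOneSubgroup ℂ)}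
    {z₀ : ↥(normOneSubgroup ℂ)} (h : {z₀}ᶜ ⊆ T) : T = univ ∨ T = {z₀}ᶜ := by
  by_cases hz : z₀ ∈ T
  · left
    apply eq_univ_of_forall
    intro z
    by_cases hzz : z = z₀
    · rw [hzz]; exact hz
    · exact h hzz
  · right
    refine Subset.antisymm (fun z hzT hzz => hz ?_) h
    rw [mem_singleton_iff.mp hzz] at hzT
    exact hzT

/-! ### The `C₀`-level core: fillable arrows have dense angular image -/

namespace C0

variable {X Y : C0}

/-- `u ↦ u/|u|` commutes with powers. [cite: MochizukiFrdII2008, Def 3.1 (ii) p.23] -/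
theorem unitPart_pow_eq (u : ℂˣ) : ∀ n : ℕ, unitPart ℂ (u ^ n) = unitPart ℂ u ^ n
  | 0 => by rw [pow_zero, pow_zero, unitPart_one]
  | n + 1 => by rw [pow_succ, pow_succ, unitPart_mul, unitPart_pow_eq u n]

/-- The twist of an arrow `b` of `D₀` on directions `O_ℂ^×`: the identity or inversion — an
involutive homeomorphism `t` with `(b(u))/|b(u)| = t(u/|u|)`. [cite: MochizukiFrdII2008, Def 3.1 (iv) p.24] -/
theorem exists_dirTwist {L K : D0} (b : L ⟶ K) :
    ∃ t : ↥(normOneSubgroup ℂ) → ↥(normOneSubgroup ℂ),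
      (∀ u : ℂˣ, unitPart ℂ (b.act u) = t (unitPart ℂ u)) ∧ (∀ z, t (t z) = z) ∧ Continuous t := by
  obtain ⟨σ, hσ⟩ : ∃ σ, D0.Hom.twists b = σ := ⟨_, rfl⟩
  refine ⟨fun z => bif σ then z⁻¹ else z, fun u => ?_, fun z => ?_, ?_⟩
  · change unitPart ℂ (D0.galAct (D0.Hom.twists b) u) = _
    rw [hσ]
    cases σ
    · rw [D0.galAct_false]; rfl
    · rw [unitPart_galAct_true]; rfl
  · cases σ
    · rfl
    · change (z⁻¹)⁻¹ = z; rw [inv_inv]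
  · cases σ
    · exact continuous_id
    · exact continuous_inv

/-- The angular image `(c/|c|) · B_X^d` of an arrow is [nonempty,] connected and open.
[cite: MochizukiFrdII2008, Ex 3.3 (i) p.28] -/
theorem isConnected_isOpen_smul_dir_pow (f : X ⟶ Y) :
    IsConnected (unitPart ℂ (scalar f) • X.region.dir ^ (degFr f : ℕ)) ∧
      IsOpen (unitPart ℂ (scalar f) • X.region.dir ^ (degFr f : ℕ)) := by
  rw [← (degFr f).natPred_add_one]
  exact ⟨isConnected_smul _ (isConnected_pow X.region.isConnected_dir _),
    isOpen_smul _ (isOpen_pow X.region.isOpen_dir _)⟩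

/-- **Dense image.** Let `f = (b, d, c) : X → Y` be an arrow of `C₀` into a complex object, and
`A'` the base-changed region `A_Y|_b` (angular part = the `b`-twist of `B_Y`). If every inclusion
`g = (id, 1, 1) : W ↪ Y` of a sub-region fits into a square `δ_X ≫ f = δ_W ≫ g` — the shape in
which the fiberwise surjectivity of `f` in `A₀`/`N₀`/`R₀` is used — then the angular image
`(c/|c|) · B_X^d` meets every [nonempty] connected open subset of the angular part of `A_Y|_b`
("cf. the fiberwise-surjectivity of `φ`, Lemma 3.2 (ix)", proof of Prop. 3.4 (viii)).
[cite: MochizukiFrdII2008, Prop 3.4 (viii) p.32] -/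
theorem smul_dir_pow_inter_nonempty_of_fill (hY : Y.IsComplexObj) (f : X ⟶ Y)
    {A' : AngularRegion ℂ}
    (hA'd : A'.dir =
      (fun z : ↥(normOneSubgroup ℂ) => unitPart ℂ ((Base f).act (z : ℂˣ))) '' Y.region.dir)
    (hfill : ∀ (W : C0) (g : W ⟶ Y), degFr g = 1 → scalar g = 1 →
      PreFrobenioid.IsIsometry toElem g → ∃ (V : C0) (δX : V ⟶ X) (δW : V ⟶ W), δX ≫ f = δW ≫ g)
    {D : Set ↥(normOneSubgroup ℂ)} (hDc : IsConnected D) (hDo : IsOpen D) (hD : D ⊆ A'.dir) :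
    (unitPart ℂ (scalar f) • X.region.dir ^ (degFr f : ℕ) ∩ D).Nonempty := by
  obtain ⟨t, ht, htt, htc⟩ := exists_dirTwist (Base f)
  have hA'd' : A'.dir = t '' Y.region.dir := by
    rw [hA'd]
    refine image_congr fun z _ => ?_
    rw [ht, unitPart_normOne_coe]
  -- the sub-region of `Y` over the same base with angular part `t ⁻¹' D`
  have hD'eq : t ⁻¹' D = t '' D := by
    ext z
    constructor
    · intro hz; exact ⟨t z, hz, htt z⟩
    · rintro ⟨w, hw, rfl⟩
      change t (t w) ∈ D
      rw [htt]; exact hw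
  have hD'c : IsConnected (t ⁻¹' D) := by
    rw [hD'eq]; exact hDc.image _ htc.continuousOn
  have hD'o : IsOpen (t ⁻¹' D) := hDo.preimage htc
  have hD'sub : t ⁻¹' D ⊆ Y.region.dir := by
    intro z hz
    have hz' : t z ∈ t '' Y.region.dir := hA'd' ▸ hD hz
    obtain ⟨y, hy, hty⟩ := hz'
    have := congrArg t hty
    rw [htt, htt] at this
    rw [← this]; exact hy
  obtain ⟨AW, hAWd, hAWt⟩ := exists_angularRegion hD'o hD'c Y.region.tip
  let W : C0 := ⟨Y.base, AW, fun h => D0.noConfusion (h.symm.trans hY)⟩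
  let g : W ⟶ Y :=
    { base := 𝟙 Y.base, degFr := 1, scalar := 1, scalar_mem := one_mem _,
      mapsTo := by
        rw [one_smul, PNat.one_coe, pow_one]
        change AW.carrier ⊆ pullRegion Y (𝟙 Y.base)
        rw [pullRegion_id]
        intro u hu
        rw [AngularRegion.mem_carrier_polar_iff] at hu ⊢
        rw [hAWd, hAWt] at hu
        exact ⟨hD'sub hu.1, hu.2⟩ }
  have hgiso : PreFrobenioid.IsIsometry toElem g := by
    rw [isIsometry_iff]
    change ‖((1 : ℂˣ) : ℂ)‖ * (AW.tip : ℝ) ^ ((1 : ℕ+) : ℕ) = Y.tip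
    rw [Units.val_one, norm_one, one_mul, PNat.one_coe, pow_one, hAWt]; rfl
  obtain ⟨V, δX, δW, hsq⟩ := hfill W g rfl rfl hgiso
  obtain ⟨a, ha, -⟩ := exists_mem_boundary V.region
  -- the three coordinates of the square
  have hbase : Base δX ≫ Base f = Base δW := by
    have h := congrArg Base hsq
    rw [base_comp', base_comp'] at h
    exact h.trans (Category.comp_id _)
  have hdeg : degFr δX * degFr f = degFr δW := by
    have h := congrArg degFr hsq
    rw [degFr_comp', degFr_comp'] at h
    exact h.trans (mul_one _)
  have hscal : (Base δX).act (scalar f) * scalar δX ^ (degFr f : ℕ) = scalar δW := by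
    have h := congrArg scalar hsq
    rw [scalar_comp', scalar_comp'] at h
    refine h.trans ?_
    change (Base δW).act 1 * scalar δW ^ ((1 : ℕ+) : ℕ) = scalar δW
    rw [map_one, one_mul, PNat.one_coe, pow_one]
  -- the two readings of the image of `a`
  have hmX : scalar δX • a ^ (degFr δX : ℕ) ∈ pullRegion X (Base δX) :=
    δX.mapsTo (Set.smul_mem_smul_set (Set.pow_mem_pow ha))
  have hmW : scalar δW • a ^ (degFr δW : ℕ) ∈ pullRegion W (Base δW) :=
    δW.mapsTo (Set.smul_mem_smul_set (Set.pow_mem_pow ha))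
  unfold pullRegion at hmX hmW
  obtain ⟨x, hx, hxe⟩ := hmX
  obtain ⟨w, hw, hwe⟩ := hmW
  have key : (Base δX).act (scalar f * x ^ (degFr f : ℕ)) = (Base δW).act w := by
    rw [map_mul, map_pow, hxe, hwe, ← hscal, ← hdeg, smul_eq_mul, smul_eq_mul, mul_pow,
      PNat.mul_coe, pow_mul, mul_assoc]
  have hws : w ∈ D0.scalars Y.base := by
    rw [show Y.base = D0.complex from hY]; exact Subgroup.mem_top _
  rw [← hbase, act_comp_of_mem _ _ hws] at key
  have key2 : scalar f * x ^ (degFr f : ℕ) = (Base f).act w := (Base δX).act.injective key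
  have key3 : (Base f).act (scalar f * x ^ (degFr f : ℕ)) = w := by
    rw [key2]; exact D0.galAct_galAct _ w
  have hwdir : t (unitPart ℂ w) ∈ D := by
    have hw1 := ((AngularRegion.mem_carrier_polar_iff AW w).1 hw).1
    rw [hAWd] at hw1
    exact hw1
  rw [← key3, ht, htt] at hwdir
  refine ⟨unitPart ℂ (scalar f * x ^ (degFr f : ℕ)), ?_, hwdir⟩
  rw [unitPart_mul, unitPart_pow_eq]
  exact Set.smul_mem_smul_set
    (Set.pow_mem_pow ((AngularRegion.mem_carrier_polar_iff _ x).1 hx).1)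

/-- **The dichotomy** (Lemma 3.2 (ix) applied to the dense image): for a fillable arrow
`f = (b, d, c) : X → Y` into a complex object, either the angular image `(c/|c|) · B_X^d` is the
whole angular part of `A_Y|_b`, or `Y` is naively isotropic and the angular image is a slit
`S¹ ∖ {z₀}`. [cite: MochizukiFrdII2008, Prop 3.4 (viii) p.32] -/
theorem smul_dir_pow_eq_or_slit_of_fill (hY : Y.IsComplexObj) (f : X ⟶ Y)
    {A' : AngularRegion ℂ} (hA'c : A'.carrier = pullRegion Y (Base f))
    (hA'd : A'.dir =
      (fun z : ↥(normOneSubgroup ℂ) => unitPart ℂ ((Base f).act (z : ℂˣ))) '' Y.region.dir)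
    (hfill : ∀ (W : C0) (g : W ⟶ Y), degFr g = 1 → scalar g = 1 →
      PreFrobenioid.IsIsometry toElem g → ∃ (V : C0) (δX : V ⟶ X) (δW : V ⟶ W), δX ≫ f = δW ≫ g) :
    unitPart ℂ (scalar f) • X.region.dir ^ (degFr f : ℕ) = A'.dir ∨
      (Y.region.IsIsotropic ∧ A'.dir = univ ∧
        ∃ z₀ : ↥(normOneSubgroup ℂ), unitPart ℂ (scalar f) • X.region.dir ^ (degFr f : ℕ) = {z₀}ᶜ) := by
  by_cases hS : unitPart ℂ (scalar f) • X.region.dir ^ (degFr f : ℕ) = A'.dir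
  · exact Or.inl hS
  right
  obtain ⟨hSc, hSo⟩ := isConnected_isOpen_smul_dir_pow f
  have hSsub : unitPart ℂ (scalar f) • X.region.dir ^ (degFr f : ℕ) ⊆ A'.dir :=
    (hom_conditions f hA'c).1
  obtain ⟨huniv, hsub⟩ := NormOne.eq_univ_of_forall_inter_nonempty hSc hSo A'.isConnected_dir
    A'.isOpen_dir hSsub hS
    (fun D hDc hDo hD => smul_dir_pow_inter_nonempty_of_fill hY f hA'd hfill hDc hDo hD)
  refine ⟨?_, huniv, ?_⟩
  · -- `B_Y` is the whole circle since its twist is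
    exact eq_univ_of_twist_image_eq_univ (Base f) (hA'd ▸ huniv)
  · rw [huniv] at hS hsub
    obtain ⟨z₀, hz₀⟩ : (univ \ unitPart ℂ (scalar f) • X.region.dir ^ (degFr f : ℕ)).Nonempty := by
      rw [nonempty_iff_ne_empty, Ne, sdiff_eq_empty, univ_subset_iff]
      exact hS
    refine ⟨z₀, Subset.antisymm (fun z hz hzz => hz₀.2 ?_) fun z hz => ?_⟩
    · rw [mem_singleton_iff.mp hzz] at hz; exact hz
    · by_contra hzS
      exact hz (hsub ⟨trivial, hzS⟩ hz₀)

end C0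

/-! ### `F₀ = N₀`: a non-invertible FSM-morphism between complex objects is a slit FSMI-morphism -/

namespace N0

/-- An object of `N₀` mapping to a complex object is complex. [cite: MochizukiFrdII2008, Ex 3.3 (iii) p.29] -/
theorem isComplexObj_of_hom {X Y : N0} (φ : X ⟶ Y) (hY : Y.carrier.IsComplexObj) :
    X.carrier.IsComplexObj := by
  have b := C0.Base (homCarrier φ)
  rw [show Y.carrier.base = D0.complex from hY] at b
  exact D0.eq_complex_of_hom_complex b

/-- Fiberwise surjectivity of `φ` in `N₀` supplies the squares over sub-region inclusions that the
`C₀`-level dense-image argument consumes. [cite: MochizukiFrdII2008, Prop 3.4 (viii) p.32] -/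
theorem fill_of_isFiberwiseSurjective {X Y : N0} (φ : X ⟶ Y) (hφ : IsFiberwiseSurjective φ) :
    ∀ (W : C0) (g : W ⟶ Y.carrier), C0.degFr g = 1 → C0.scalar g = 1 →
      PreFrobenioid.IsIsometry C0.toElem g →
        ∃ (V : C0) (δX : V ⟶ X.carrier) (δW : V ⟶ W), δX ≫ homCarrier φ = δW ≫ g := by
  intro W g hg1 _ hgiso
  let W' : N0 := ⟨⟨W⟩⟩
  let γ : W' ⟶ Y := homMk (X := W') g hgiso hg1
  obtain ⟨V', δX', δW', hsq⟩ := hφ γ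
  refine ⟨V'.carrier, homCarrier δX', homCarrier δW', ?_⟩
  have := congrArg homCarrier hsq
  rw [homCarrier_comp, homCarrier_comp] at this
  exact this

/-- **[FrdII] Prop. 3.4 (viii), `F₀ = N₀`, the linear case of the FSMI-factorisation**: an
FSM-morphism of `N₀` between complex objects that is not an isomorphism is an FSMI-morphism (it is
a slit morphism: by Lemma 3.2 (ix) its angular image is `S¹ ∖ {pt}` and its codomain is isotropic,
whence irreducibility). [cite: MochizukiFrdII2008, Prop 3.4 (viii) p.32] -/
theorem isFSMI_of_isFSM_of_not_isIso {X Y : N0} (hY : Y.carrier.IsComplexObj) (φ : X ⟶ Y)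
    (hφ : IsFSM φ) (hφ' : ¬ IsIso φ) : IsFSMI φ := by
  refine ⟨hφ, hφ', fun M β α hfac => ?_⟩
  have hXc : X.carrier.IsComplexObj := isComplexObj_of_hom φ hY
  have hMc : M.carrier.IsComplexObj := isComplexObj_of_hom α hY
  -- the data of `φ`, `β`, `α` in `C₀`
  have hlin : C0.degFr (homCarrier φ) = 1 := φ.2
  have hiso : PreFrobenioid.IsIsometry C0.toElem (homCarrier φ) := φ.1.2
  have hlinβ : C0.degFr (homCarrier β) = 1 := β.2
  have hisoβ : PreFrobenioid.IsIsometry C0.toElem (homCarrier β) := β.1.2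
  have hlinα : C0.degFr (homCarrier α) = 1 := α.2
  have hisoα : PreFrobenioid.IsIsometry C0.toElem (homCarrier α) := α.1.2
  obtain ⟨A', hA'c, hA't, hA'd, -⟩ := exists_pulledRegion Y.carrier (C0.Base (homCarrier φ))
  rcases C0.smul_dir_pow_eq_or_slit_of_fill hY (homCarrier φ) hA'c hA'd
      (fill_of_isFiberwiseSurjective φ hφ.1) with hfull | ⟨hYiso, -, z₀, hz₀⟩
  · -- the image fills: `φ` would be an isomorphism
    exfalso
    apply hφ'
    haveI : IsIso (C0.Base (homCarrier φ)) := D0.isIso_of_isComplex _ hXc hY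
    rw [hlin, PNat.one_coe, pow_one] at hfull
    haveI : IsIso (homCarrier φ) :=
      C0.isIso_of_isometry_of_dir (homCarrier φ) ⟨hlin, (C0.isBaseIso_iff _).mpr inferInstance⟩ hiso hA'c hA't hfull.symm.subset
    exact isIso_of_isIso_carrier φ
  · -- the slit case: `B_X = S¹ ∖ {z₁}`
    rw [hlin, PNat.one_coe, pow_one] at hz₀
    have hX : X.carrier.region.dir = {(unitPart ℂ (C0.scalar (homCarrier φ)))⁻¹ • z₀}ᶜ := by
      have := congrArg (fun T => (unitPart ℂ (C0.scalar (homCarrier φ)))⁻¹ • T) hz₀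
      simp only [inv_smul_smul] at this
      rw [this, Set.smul_set_compl, Set.smul_set_singleton]
    -- the intermediate object `M` contains the `β`-image of the slit
    obtain ⟨A'', hA''c, hA''t, hA''d, -⟩ := exists_pulledRegion M.carrier (C0.Base (homCarrier β))
    have hβdir := (C0.hom_conditions (homCarrier β) hA''c).1
    rw [hlinβ, PNat.one_coe, pow_one, hX, Set.smul_set_compl, Set.smul_set_singleton] at hβdir
    haveI : IsIso (C0.Base (homCarrier β)) := D0.isIso_of_isComplex _ hXc hMc
    haveI : IsIso (C0.Base (homCarrier α)) := D0.isIso_of_isComplex _ hMc hY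
    rcases NormOne.eq_univ_or_eq_compl_of_compl_subset hβdir with hMu | hMs
    · -- `M` is isotropic: `α` is an isomorphism
      left
      have hMiso : M.carrier.region.dir = univ :=
        C0.eq_univ_of_twist_image_eq_univ (C0.Base (homCarrier β)) (hA''d ▸ hMu)
      obtain ⟨A₃, hA₃c, hA₃t, -, -⟩ := exists_pulledRegion Y.carrier (C0.Base (homCarrier α))
      haveI : IsIso (homCarrier α) :=
        C0.isIso_of_isometry_of_dir (homCarrier α) ⟨hlinα, (C0.isBaseIso_iff _).mpr inferInstance⟩ hisoα hA₃c hA₃t (by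
          rw [hMiso, Set.smul_set_univ]; exact subset_univ _)
      exact isIso_of_isIso_carrier α
    · -- `B_M` is the `β`-image of the slit: `β` is an isomorphism
      right
      haveI : IsIso (homCarrier β) :=
        C0.isIso_of_isometry_of_dir (homCarrier β) ⟨hlinβ, (C0.isBaseIso_iff _).mpr inferInstance⟩ hisoβ hA''c hA''t (by
          rw [hMs, hX, Set.smul_set_compl, Set.smul_set_singleton])
      exact isIso_of_isIso_carrier β

/-- **[FrdII] Prop. 3.4 (viii) for `F₀ = N₀`, condition (a) of FSMFF-type between complex objects**:
every FSM-morphism of the non-rigidified angloid `N₀` between complex objects that is not an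
isomorphism is a (one-term) composite of FSMI-morphisms. [cite: MochizukiFrdII2008, Prop 3.4 (viii) p.32] -/
theorem exists_isFSMIChain_of_isFSM {X Y : N0} (hY : Y.carrier.IsComplexObj) (φ : X ⟶ Y)
    (hφ : IsFSM φ) (hφ' : ¬ IsIso φ) : ∃ n, IsFSMIChain φ n :=
  ⟨1, IsFSMIChain.single φ (isFSMI_of_isFSM_of_not_isIso hY φ hφ hφ')⟩

end N0

end ArchFrd

end

end Literature.AlgebraicGeometry.Frobenioids
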